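import Mathlib
import HarnessLib
import Literature.Analysis.FluidPDE.ClassicalSolution
import Literature.Analysis.FluidPDE.Vorticity
import Literature.Analysis.FluidPDE.SuitableWeak
import Summits.NavierStokesRegularity.NavierStokesRegularity.Theorems.QuarterLogPincerBeadCensusDefs
import Summits.NavierStokesRegularity.NavierStokesRegularity.Theorems.QuarterLogPincerBeadCensusKernel
import Summits.NavierStokesRegularity.NavierStokesRegularity.Theorems.QuarterLogPincerCubicRungDefs
import Summits.NavierStokesRegularity.NavierStokesRegularity.Theorems.QuarterLogPincerThinCascadeDefs
import Summits.NavierStokesRegularity.NavierStokesRegularity.Theorems.QuarterLogPincerTypeIQuantSubcubicExpStubUniformScaledEnergy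
import Summits.NavierStokesRegularity.NavierStokesRegularity.Theorems.QuarterLogPincerTypeIQuantSubcubicExpFrameTools
import Summits.NavierStokesRegularity.NavierStokesRegularity.Theorems.QuarterLogPincerTypeIQuantSubcubicExpZoomEnergyA
import Summits.NavierStokesRegularity.NavierStokesRegularity.Theorems.QuarterLogPincerTypeIQuantSubcubicExpRescaleTools
import Summits.NavierStokesRegularity.NavierStokesRegularity.Theorems.QuarterLogPincerTypeIQuantSubcubicExpUnitScaleTools
import Summits.NavierStokesRegularity.NavierStokesRegularity.Theorems.QuarterLogPincerHelmholtzCentreDefs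
import Summits.NavierStokesRegularity.NavierStokesRegularity.Theorems.QuarterLogPincerHelmholtzCentreShellKernel
import Summits.NavierStokesRegularity.NavierStokesRegularity.Theorems.QuarterLogPincerFlatChainDefs
import Summits.NavierStokesRegularity.NavierStokesRegularity.Theorems.QuarterLogPincerFlatChainTypeIEpoch
import Literature.Analysis.FluidPDE.BarkerPrangeLocalizedSmoothingBounds
import Literature.Analysis.FluidPDE.BarkerPrangeConcentrationProofs
import Literature.Analysis.FluidPDE.BackwardHeatPointwise
import Literature.Analysis.FluidPDE.AncientWeakL3BackwardLiouvilleAssembly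
import Literature.Analysis.FluidPDE.LocalEnergySolutionsOn
import Literature.Analysis.FluidPDE.LocalLerayExistence
import Literature.Analysis.FluidPDE.BoundedMildWeakL3LocalEnergySolution
import Literature.Analysis.FluidPDE.BoundedMildWeakL3RieszPressure
import Literature.Analysis.FluidPDE.KatoLocalLerayPressureProofs
import Literature.Analysis.FluidPDE.VeryWeakToDistributional
import Literature.Analysis.FluidPDE.VeryWeakToDistributionalFour
import Literature.Analysis.FluidPDE.ClassicalBoundedWeak
import Literature.Analysis.FluidPDE.MildSolution
import Literature.Analysis.SingularIntegrals.HardyLittlewoodSobolev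
import Literature.Analysis.FluidPDE.VorticityCalculus
import Literature.Analysis.FluidPDE.BiotSavartWeakLp

/-!
# Route `QuarterLogPincer`, crux `TypeIQuantSubcubicExp` (stmt-NavierStokesRegularity-24077), line `flat_chain` —
# OBJECTS part 3 (Defs file): Q3 `QuietSliceSmallCube` and the §10 plumbing objects `sliceField`, P `LocalEnergySlice`,
# P♭ `LocalEnergySliceLES`, P♭♭ `SlicePressure`, verbatim

VERBATIM port of the remaining statement objects of ns-idea-7 g14's workfile (LINE g14-3 `quiet_seed`; idea-crit-4 PASS A−, re-stamped
by hash on v1.7/v1.11), namespace `…Cruxes.TypeIQuantSubcubicExp.FlatChain` (NOT the annex namespace `…Theorems.FlatChain` — the line's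
kernels and S1 proof consume the crux-namespace constants, so the author rebases by deleting the local copies, as for parts 1–2).
No stub is proved here.
HONEST FRAME: ports of the author's kernel-checked in-file proofs about HYPOTHETICAL Type-I classical solutions; no census node,
⟨24077⟩, W7 or Navier–Stokes regularity is proved (OPEN).  pub-ns-dss typer (g39), `--supports stmt-NavierStokesRegularity-24077`;
texts by ns-idea-7 (g14), workfile `Cruxes/TypeIQuantSubcubicExp/Lines/flat_chain.lean` v1.12 (sha f4adcfe506ba), VERBATIM.
-/

set_option linter.dupNamespace false

namespace Summit.NavierStokesRegularity.NavierStokesRegularity.Cruxes.TypeIQuantSubcubicExp.FlatChain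

noncomputable section

open MeasureTheory Set Metric
open scoped ENNReal NNReal Classical
open Literature.Analysis Literature.Analysis.FluidPDE
open Summit.NavierStokesRegularity.NavierStokesRegularity.Cruxes.TypeIQuantSubcubicExp.BeadCensus
open Summit.NavierStokesRegularity.NavierStokesRegularity.Cruxes.TypeIQuantSubcubicExp.CubicRung

/-- **Q3 `QuietSliceSmallCube`** — pure harmonic analysis at one time slice: for a `C²` divergence-free field `v`
on `ℝ³`, `0 < r`, `2r ≤ R`,
`∫_{B(x₀,2r)}‖v‖³ ≤ C·( r^{3/2}(∫_{B(x₀,2R)}‖curl v‖²)^{3/2} + r³(R⁻³∫_{B(x₀,2R)}‖v‖)³ + r³(R⁻²∫_{B(x₀,2R)}‖curl v‖)³ )`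
with an ABSOLUTE constant `C`.  PROVED below (§9a `quietSliceSmallCube_holds`, v1.3; via STRONG HLS + Cauchy–Schwarz).  Route: at each `x ∈ B(x₀,2r)`, H2♭ `ShellKernelBound` (PROVED) with the cutoff ball
`B(x,R) ⊆ B(x₀,2R)` gives `‖v(x) − K₃∗(cutVorticity v x R)(x)‖ ≤ C_H(R⁻³∫_{B(x₀,2R)}‖v‖ + R⁻²∫_{B(x₀,2R)}‖curl v‖)`
(monotonicity of the nonnegative integrals in the domain); the main term is dominated pointwise by the Riesz potential
`(4π)⁻¹ I₁(‖curl v‖·1_{B(x₀,2R)})(x)` (`enorm_biotSavart_le_rieszPotential`, cutoff `≤ 1`), whose weak-`L⁶` quasi-norm is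
`≤ C‖curl v‖_{L²(B(x₀,2R))}` (tree weak HLS `exists_weakHLS_one_R3` / `meas_lt_norm_biotSavart_le` at `p = 2`, Chebyshev
`eWeakLpPow ω 2 ≤ ‖ω‖₂²`), and `∫_E g³ ≤ 2C³|E|^{1/2}‖f‖₂³` for a weak-`L⁶` function on a set of finite measure (layer
cake, split at `λ³ = C³‖f‖₂³|E|^{-1/2}`); Minkowski in `L³(B(x₀,2r))`.  Why it might fail: not as mathematics (each step is a
tree theorem or a layer-cake); porting cost M (ENNReal bookkeeping).  [Stein 1970 Ch. V §1; Majda–Bertozzi §2.4.1; tree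
`BiotSavartWeakLp`, `…HelmholtzCentreShellKernel`]  Size M. -/
def QuietSliceSmallCube : Prop :=
  ∃ C : ℝ, 0 < C ∧
    ∀ (v : EuclideanSpace ℝ (Fin 3) → EuclideanSpace ℝ (Fin 3)), ContDiff ℝ 2 v →
      VectorCalculus.IsDivFree v →
      ∀ (x₀ : EuclideanSpace ℝ (Fin 3)) (r R : ℝ), 0 < r → 2 * r ≤ R →
        ∫⁻ x in ball x₀ (2 * r), ‖v x‖ₑ ^ (3 : ℝ) ≤
          ENNReal.ofReal (C *
            (r ^ (3 / 2 : ℝ) * (∫ x in ball x₀ (2 * R), ‖curl v x‖ ^ 2) ^ (3 / 2 : ℝ) +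
              r ^ 3 * ((R ^ 3)⁻¹ * ∫ x in ball x₀ (2 * R), ‖v x‖) ^ 3 +
              r ^ 3 * ((R ^ 2)⁻¹ * ∫ x in ball x₀ (2 * R), ‖curl v x‖) ^ 3))

/-! ## §10 (v1.6) The shared plumbing lemma P = `LocalEnergySlice` (critic N1 on g14-3, 12:53Z: "type it once as a support
Prop BEFORE either port starts; then ONE hand closes Q4 and β back-to-back")

β (`LightSliceRegular`) and Q4 (`QuietSliceSmallCube → LevelConcentration`) consume the PROVED small-data local smoothing
`BarkerPrange2020_thm1_slab_bounds`, whose solution class is Seregin's local energy class on `ℝ³ × (0,S)` with datum in `E²`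
and a uniformly-local `L²` bound.  P says that the Navier–Stokes rescaling of the crux frame about any admissible `(t*, x)` at
any scale `r` IS such a solution, with the uloc constant a function of the Type-I constant only (from I1 clause A,
`ThinCascade.stub_uniformScaledEnergy`, PROVED).  PORT (all inputs PROVED; `Lines/flat-chain.md` § PORT MAP): time shift
`IsClassicalNSSolutionOn.comp_add_right` + scaling `ThinCascade.rescale_classical` / `rescale_lintegral_sq` / `rescale_rate` +
`ThinCascade.pressure_normalised_of_classical` (`p = Π[u] + C(t)` a.e.; suitability is insensitive to `C(t)` because `div u = 0`) +
`IsClassicalNSSolutionOn.onRegion` / `IsClassicalNSSolutionOnRegion.isSuitableWeakSolutionOn` + `isLocalEnergySolutionOn_of_bounded_suitable`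
(its hypotheses: joint continuity ✓ classical; a bound `K` ✓ Type-I away from `T+τ`, any `K` will do; `u ∈ L⁴` of the slab ⇐ bounded ×
uniformly `L²` slices; `Π[u] ∈ L²` of the slab ⇐ Calderón–Zygmund on `u ⊗ u ∈ L²`) + `memE2_of_memLp` (`p = 2`) + I1(A) at a vertex
`T' ∈ [max(t*, r²), min(t* + r², T)]` (non-empty by `0 ≤ t*`, `r² ≤ T`, `t* ≤ T`) after `ThinCascade.frame_restrict`/`typeI_restrict`,
transported by `ThinCascade.setLIntegral_ball_comp_add_smul`: `‖v(0)‖²_{L²(B(x₁,1))} = r⁻¹∫_{B(x + r x₁, r)}‖u(t*)‖² ≤ C_I(M)`.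
Size L.  Why it might fail: it cannot mathematically (classical, bounded, `L²`-slice solutions are local energy solutions); the
risk is only bookkeeping (the decay clause of `IsLocalEnergySolutionOn` and of `MemE2` needs `u(t*) ∈ L²`, which the frame's
`m = 0` Sobolev clause supplies). -/

/-- The Navier–Stokes rescaling of `u` about `(t*, x)` at scale `r`: `v(σ, y) = r · u(t* + r²σ, x + r y)` — typed (v1.7) as
the tree's `r • stPull (r²) r t* x u` so that the rescaling tool-kit (`ThinCascade.rescale_*`, `lintegral_sq_ball_zoom`,
`IsClassicalNSSolutionOn.stRescale`) applies verbatim; `sliceField_apply` is the pointwise form (`rfl`). -/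
noncomputable def sliceField (u : ℝ → EuclideanSpace ℝ (Fin 3) → EuclideanSpace ℝ (Fin 3)) (x : EuclideanSpace ℝ (Fin 3))
    (tstar r : ℝ) : ℝ → EuclideanSpace ℝ (Fin 3) → EuclideanSpace ℝ (Fin 3) :=
  r • stPull (r ^ 2) r tstar x u

/-- Pointwise form of `sliceField` (`rfl`). -/
@[simp] theorem sliceField_apply (u : ℝ → EuclideanSpace ℝ (Fin 3) → EuclideanSpace ℝ (Fin 3))
    (x : EuclideanSpace ℝ (Fin 3)) (tstar r σ : ℝ) (y : EuclideanSpace ℝ (Fin 3)) :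
    sliceField u x tstar r σ y = r • u (tstar + r ^ 2 * σ) (x + r • y) := rfl

/-- **P = `LocalEnergySlice`** (support Prop, v1.6; registered stub `stub_localEnergySlice`, size L; β and Q4 are `M` GIVEN P).
For every Type-I constant `M` there is `M̃ = M̃(M) > 0` such that for every crux frame `(u,p)` on `[0,T]` with the rate
`‖u(t,x)‖ ≤ M(T+τ−t)^{-1/2}`, every centre `x`, base time `t* ≥ 0`, scale `r > 0` with `r² ≤ T` and window length `S ∈ (0,1]` with
`t* + S r² ≤ T`, the rescaled field `v = sliceField u x t* r` on `[0,S]` is, for SOME pressure `π`, a local energy solution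
`IsLocalEnergySolutionOn S 1 (v 0) v π` (Seregin 2014 Def. B.1, tree) whose datum lies in `E²` (`MemE2`) with
`‖v 0‖_{L²(B(x₁,1))} ≤ M̃` for all `x₁`.  [Seregin2014 App. B; KangMiuraTsai2021 Def. 3.1; BarkerPrange2020 Def. 16; tree names in §10] -/
def LocalEnergySlice : Prop :=
  ∀ M : ℝ, ∃ Mt : ℝ, 0 < Mt ∧
    ∀ (T τ : ℝ) (u : ℝ → EuclideanSpace ℝ (Fin 3) → EuclideanSpace ℝ (Fin 3))
      (p : ℝ → EuclideanSpace ℝ (Fin 3) → ℝ),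
      (IsClassicalNSSolutionOn (Icc 0 T) 1 0 u p ∧
        ∀ m : ℕ, ∃ C : NNReal, ∀ t ∈ Icc 0 T, eLpNorm (iteratedFDeriv ℝ m (u t)) 2 volume ≤ C) →
      0 < τ →
      (∀ t ∈ Icc 0 T, ∀ x : EuclideanSpace ℝ (Fin 3), ‖u t x‖ ≤ M * (T + τ - t) ^ (-(1 / 2 : ℝ))) →
      ∀ (x : EuclideanSpace ℝ (Fin 3)) (tstar r S : ℝ), 0 < r → 0 < S → S ≤ 1 → 0 ≤ tstar →
        r ^ 2 ≤ T → tstar + S * r ^ 2 ≤ T →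
        ∃ π : ℝ → EuclideanSpace ℝ (Fin 3) → ℝ,
          IsLocalEnergySolutionOn S 1 (sliceField u x tstar r 0) (sliceField u x tstar r) π ∧
          MemE2 (sliceField u x tstar r 0) ∧
          ∀ x₁ : EuclideanSpace ℝ (Fin 3),
            eLpNorm (sliceField u x tstar r 0) 2 (volume.restrict (ball x₁ 1)) ≤ ENNReal.ofReal Mt

/-- **P♭ = `LocalEnergySliceLES`** (v1.7): the local-energy-solution clause of P ALONE — the REGISTERED residual of P
(`stub_localEnergySliceLES`, size L−); the `E²` clause and the uloc clause of P are PROVED below (`sliceField_memE2`,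
`sliceField_eLpNorm_unitBall_le`) and `localEnergySlice_of_les : LocalEnergySliceLES → LocalEnergySlice` is kernel-checked. -/
def LocalEnergySliceLES : Prop :=
  ∀ (M T τ : ℝ) (u : ℝ → EuclideanSpace ℝ (Fin 3) → EuclideanSpace ℝ (Fin 3))
    (p : ℝ → EuclideanSpace ℝ (Fin 3) → ℝ),
    (IsClassicalNSSolutionOn (Icc 0 T) 1 0 u p ∧
      ∀ m : ℕ, ∃ C : NNReal, ∀ t ∈ Icc 0 T, eLpNorm (iteratedFDeriv ℝ m (u t)) 2 volume ≤ C) →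
    0 < τ →
    (∀ t ∈ Icc 0 T, ∀ x : EuclideanSpace ℝ (Fin 3), ‖u t x‖ ≤ M * (T + τ - t) ^ (-(1 / 2 : ℝ))) →
    ∀ (x : EuclideanSpace ℝ (Fin 3)) (tstar r S : ℝ), 0 < r → 0 < S → S ≤ 1 → 0 ≤ tstar →
      r ^ 2 ≤ T → tstar + S * r ^ 2 ≤ T →
      ∃ π : ℝ → EuclideanSpace ℝ (Fin 3) → ℝ,
        IsLocalEnergySolutionOn S 1 (sliceField u x tstar r 0) (sliceField u x tstar r) π

/-- **P♭♭ = `SlicePressure`**: the rescaled slice solves Navier–Stokes in the sense of distributions on the slab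
`(0,S) × ℝ³` with SOME pressure in `L²` of the slab.  (The natural witness is the slab Riesz pressure of `v`,
`exists_rieszPressure_two_slab (sliceField_memLp_four …)`; what remains is the pressure swap `q ↦ Π[v]`, `q − Π[v] = c(t)`
a.e. by `pressure_ae_eq_rieszPressure_add_const`.) -/
def SlicePressure : Prop :=
  ∀ (M T τ : ℝ) (u : ℝ → EuclideanSpace ℝ (Fin 3) → EuclideanSpace ℝ (Fin 3))
    (p : ℝ → EuclideanSpace ℝ (Fin 3) → ℝ),
    (IsClassicalNSSolutionOn (Icc 0 T) 1 0 u p ∧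
      ∀ m : ℕ, ∃ C : NNReal, ∀ t ∈ Icc 0 T, eLpNorm (iteratedFDeriv ℝ m (u t)) 2 volume ≤ C) →
    0 < τ →
    (∀ t ∈ Icc 0 T, ∀ x : EuclideanSpace ℝ (Fin 3), ‖u t x‖ ≤ M * (T + τ - t) ^ (-(1 / 2 : ℝ))) →
    ∀ (x : EuclideanSpace ℝ (Fin 3)) (tstar r S : ℝ), 0 < r → 0 < S → S ≤ 1 → 0 ≤ tstar →
      r ^ 2 ≤ T → tstar + S * r ^ 2 ≤ T →
      ∃ π : ℝ → EuclideanSpace ℝ (Fin 3) → ℝ,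
        MemLp (Function.uncurry π) 2 (volume.restrict (Ioo 0 S ×ˢ (univ : Set (EuclideanSpace ℝ (Fin 3))))) ∧
        IsDistributionalNSSolutionOn (slab (EuclideanSpace ℝ (Fin 3)) (Ioo 0 S) isOpen_Ioo) 1 0
          (sliceField u x tstar r) π


end

end Summit.NavierStokesRegularity.NavierStokesRegularity.Cruxes.TypeIQuantSubcubicExp.FlatChain

/-!
## Part 2 (appended, v1.14 of `Lines/flat_chain.lean`, LINE g15-1 «light_slice», §12): the two registered obligations B1, B2 of β|P

ns-idea-7 g15 splits β|P `LocalEnergySlice → LightSliceRegular` into B1|P `stub_sliceWindowBound_of_slice : LocalEnergySlice →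
SliceWindowBound` (P + Barker–Prange 2020 Thm 1 (i) on the light slice ⇒ a velocity bound `C_b s^{-1/2}` on the window
`(t₁ − s, t₁) × B(x, ϑ√s/6)`) and B2 `stub_boundedCylinderRegular : BoundedCylinderRegular` (bounded cylinders of a Type-I frame are
quantitatively regular up to the vertex), glued by the sorry-free kernel `lightSliceRegular_of_windowBound_of_cylinder`.  The two
definitions below are VERBATIM v1.14 (crux namespace, same FQNs).  HONEST FRAMING: definitions only; nothing is proved here.
-/

namespace Summit.NavierStokesRegularity.NavierStokesRegularity.Cruxes.TypeIQuantSubcubicExp.FlatChain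

open MeasureTheory Set Metric
open scoped ENNReal NNReal
open Literature.Analysis Literature.Analysis.FluidPDE

/-- **B1 `SliceWindowBound`** (size M; B1|P `stub_sliceWindowBound_of_slice` REGISTERED v1.14).  For `M ≥ 1` there are
`γ = γ_BP > 0`, `ϑ = ϑ(M) ≥ 2`, `C_b = C_b(M) > 0`: in the crux frame with rate `M`, if the cube mass of `u(t₁ − 2s)` on the test
ball `B(x, ϑ√s)` is `≤ γ³` (`0 < s`, `2s ≤ t₁ ≤ T`, `(ϑ/2)²s ≤ T`), then `‖u(t, y)‖ ≤ C_b s^{-1/2}` for `t ∈ (t₁ − s, t₁)`,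
`y ∈ B(x, ϑ√s/6)` — P + Barker–Prange 2020 Thm 1 (i) (tree `BarkerPrange2020_thm1_slab_bounds`, PROVED) on the rescaled slice
`sliceField u x (t₁ − 2s) (ϑ√s/2)` with `ϑ² = 8/S_BP`, a.e. → everywhere by continuity. [BarkerPrange2020 Thm 1 (i)] -/
def SliceWindowBound : Prop :=
  ∀ M : ℝ, 1 ≤ M → ∃ γ ϑ Cb : ℝ, 0 < γ ∧ 2 ≤ ϑ ∧ 0 < Cb ∧
    ∀ (T τ : ℝ) (u : ℝ → EuclideanSpace ℝ (Fin 3) → EuclideanSpace ℝ (Fin 3))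
      (p : ℝ → EuclideanSpace ℝ (Fin 3) → ℝ),
      (IsClassicalNSSolutionOn (Icc 0 T) 1 0 u p ∧
        ∀ m : ℕ, ∃ C : NNReal, ∀ t ∈ Icc 0 T, eLpNorm (iteratedFDeriv ℝ m (u t)) 2 volume ≤ C) →
      0 < τ →
      (∀ t ∈ Icc 0 T, ∀ x : EuclideanSpace ℝ (Fin 3), ‖u t x‖ ≤ M * (T + τ - t) ^ (-(1 / 2 : ℝ))) →
      ∀ (t₁ s : ℝ) (x : EuclideanSpace ℝ (Fin 3)), 0 < s → 2 * s ≤ t₁ → (ϑ / 2) ^ 2 * s ≤ T → t₁ ≤ T →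
        (∫⁻ y in ball x (ϑ * Real.sqrt s), ‖u (t₁ - 2 * s) y‖ₑ ^ (3 : ℝ) ≤ ENNReal.ofReal (γ ^ 3)) →
        ∀ t ∈ Ioo (t₁ - s) t₁, ∀ y ∈ ball x (ϑ * Real.sqrt s / 6), ‖u t y‖ ≤ Cb * s ^ (-(1 / 2 : ℝ))

/-- **B2 `BoundedCylinderRegular`** (size M; `stub_boundedCylinderRegular` REGISTERED v1.14) — BOUNDED CYLINDERS OF A TYPE-I FRAME
ARE QUANTITATIVELY REGULAR UP TO THE VERTEX.  For `M ≥ 1`, `B > 0` there are `κ = κ(M,B) ∈ (0,1]`, `c_K ≥ 1`: in the crux frame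
with rate `M`, a backward cylinder `Q_ϱ(z)` with `ϱ² ≤ z₁ ≤ T` on which `‖u‖ ≤ B/ϱ` carries `‖∇ʲu(t,x)‖ ≤ c_K (κϱ)^{-(j+1)}` for
`t ∈ [z₁ − (κϱ/2)², z₁]`, `x ∈ B(z₂, κϱ/2)`, `j ≤ 2`.  Mechanism = the E-chain's `ColdSmoothing.coldRegularity_of_stubs` with
coldness replaced by boundedness (`cknC_le_of_ae_bound_subset`; CS2 `ColdSmoothing.stub_coldPressureGauge`; one Seregin–Šverák
pressure-decay step `seregin_sverak_pressure_decay_holds`; CS3 `ColdSmoothing.stub_smallEnergySmoothing` — all PROVED), cf. the tree's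
`FlatChain.boundedRegularity` (`…FlatChainBoundedRegularity`). [Seregin–Šverák 2009; Seregin 2014 Lemma 6.1; CKN 1982] -/
def BoundedCylinderRegular : Prop :=
  ∀ M B : ℝ, 1 ≤ M → 0 < B → ∃ κ cK : ℝ, 0 < κ ∧ κ ≤ 1 ∧ 1 ≤ cK ∧
    ∀ (T τ : ℝ) (u : ℝ → EuclideanSpace ℝ (Fin 3) → EuclideanSpace ℝ (Fin 3))
      (p : ℝ → EuclideanSpace ℝ (Fin 3) → ℝ),
      (IsClassicalNSSolutionOn (Icc 0 T) 1 0 u p ∧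
        ∀ m : ℕ, ∃ C : NNReal, ∀ t ∈ Icc 0 T, eLpNorm (iteratedFDeriv ℝ m (u t)) 2 volume ≤ C) →
      0 < τ →
      (∀ t ∈ Icc 0 T, ∀ x : EuclideanSpace ℝ (Fin 3), ‖u t x‖ ≤ M * (T + τ - t) ^ (-(1 / 2 : ℝ))) →
      ∀ (z : ℝ × EuclideanSpace ℝ (Fin 3)) (ϱ : ℝ), 0 < ϱ → ϱ ^ 2 ≤ z.1 → z.1 ≤ T →
        (∀ w ∈ parabolicCylinder ϱ z, ‖u w.1 w.2‖ ≤ B / ϱ) →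
        ∀ t ∈ Icc (z.1 - (κ * ϱ / 2) ^ 2) z.1, ∀ x ∈ ball z.2 (κ * ϱ / 2), ∀ j : ℕ, j ≤ 2 →
          ‖iteratedFDeriv ℝ j (u t) x‖ ≤ cK * (κ * ϱ) ^ (-((j : ℝ) + 1))

end Summit.NavierStokesRegularity.NavierStokesRegularity.Cruxes.TypeIQuantSubcubicExp.FlatChain
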